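import Mathlib
import Literature.Analysis.PDE.Wave1DFarSolutionSpace

/-!
# Finite linear combinations of far solutions: closure, data, non-radiation, `t`-polynomials

Analysis/PDE support file (everything proved). For a finite family `B₀, …, B_{M−1}` of far solutions
of `ψ_tt − ψ_xx + Wψ = 0` on `{x ≥ 1}` (global `C²`, residual vanishing on `{x ≥ 1}`, finite
`W`-energy on `(1,∞)`; `W ≥ 0` continuous) and coefficients `c`, the combination
`ψ_c(t,x) = Σ_m c_m B_m(t,x)` is again a far solution (`farSol_lincomb`), its Cauchy data are the
combinations of the data (`lincomb_data`), it is NON-RADIATING through the far channel as soon as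
every `B_m` is (`farEnergy_lincomb_tendsto_zero`: `√E(t)` is subadditive,
`Wave1DFarSolutionSpace.lean`), and it is a polynomial in `t` on the unit far cone
`{x > 1 + |t|}` as soon as every `B_m` is (`tPolynomial_lincomb`). This is the span of the true
non-radiating kernel elements in the kernel-absorption step of the far-side channel estimate of
`FixedModeChannels` (route PhotonSphereChannels, stmt-FinalStateConjecture-10048). Folklore.
-/

noncomputable section

namespace Literature.Analysis.PDE

open Set Filter MeasureTheory Finset
open scoped _root_.Topology

variable {W : ℝ → ℝ} {M : ℕ} {B : Fin M → ℝ → ℝ → ℝ}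

/-- Combinations over a finset of indices, inserting one index. [folklore] -/
theorem lincomb_insert {s : Finset (Fin M)} {a : Fin M} (ha : a ∉ s) (c : Fin M → ℝ) :
    (fun t x => ∑ m ∈ insert a s, c m * B m t x)
      = fun t x => c a * B a t x + ∑ m ∈ s, c m * B m t x := by
  funext t x; rw [sum_insert ha]

section FarSol

variable (hW : Continuous W) (hW0 : ∀ x, 0 ≤ W x) (hB : ∀ m, ContDiff ℝ 2 (Function.uncurry (B m)))
  (hres : ∀ m t x, 1 ≤ x →
    iteratedDeriv 2 (fun τ => B m τ x) t - iteratedDeriv 2 (B m t) x + W x * B m t x = 0)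
  (hint : ∀ m, IntegrableOn (fun x => deriv (fun τ => B m τ x) 0 ^ 2 + deriv (B m 0) x ^ 2
    + W x * B m 0 x ^ 2) (Ioi 1))
include hW hW0 hB hres hint

/-- **Combinations over a finset of indices are far solutions** (stated for any function equal to
the combination, to keep the slices syntactically flexible). [folklore] -/
theorem farSol_lincomb_finset (c : Fin M → ℝ) (s : Finset (Fin M)) :
    ∀ ψ : ℝ → ℝ → ℝ, ψ = (fun t x => ∑ m ∈ s, c m * B m t x) →
    ContDiff ℝ 2 (Function.uncurry ψ) ∧
    (∀ t x, 1 ≤ x → iteratedDeriv 2 (fun τ => ψ τ x) t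
      - iteratedDeriv 2 (ψ t) x + W x * ψ t x = 0) ∧
    IntegrableOn (fun x => deriv (fun τ => ψ τ x) 0 ^ 2
      + deriv (ψ 0) x ^ 2 + W x * ψ 0 x ^ 2) (Ioi 1) := by
  classical
  induction s using Finset.induction_on with
  | empty =>
    intro ψ hψ
    subst hψ
    simp only [sum_empty]
    refine ⟨contDiff_const, fun t x _ => by simp, ?_⟩
    simp
  | insert a s ha ih =>
    intro ψ hψ
    subst hψ
    obtain ⟨h1, h2, h3⟩ := ih _ rfl
    obtain ⟨g1, g2, g3⟩ := farSol_smul (W := W) (hB a) (hres a) (hint a) (c a)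
    obtain ⟨k1, k2, k3⟩ := farSol_add hW hW0 g1 g2 g3 h1 h2 h3
    rw [lincomb_insert ha]
    exact ⟨k1, k2, k3⟩

/-- **Linear combinations of far solutions are far solutions.** [folklore] -/
theorem farSol_lincomb (c : Fin M → ℝ) :
    ContDiff ℝ 2 (Function.uncurry fun t x => ∑ m, c m * B m t x) ∧
    (∀ t x, 1 ≤ x → iteratedDeriv 2 (fun τ => ∑ m, c m * B m τ x) t
      - iteratedDeriv 2 (fun y => ∑ m, c m * B m t y) x + W x * (∑ m, c m * B m t x) = 0) ∧
    IntegrableOn (fun x => deriv (fun τ => ∑ m, c m * B m τ x) 0 ^ 2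
      + deriv (fun y => ∑ m, c m * B m 0 y) x ^ 2 + W x * (∑ m, c m * B m 0 x) ^ 2) (Ioi 1) :=
  farSol_lincomb_finset hW hW0 hB hres hint c Finset.univ _ rfl

/-- **Linear combinations of non-radiating far solutions are non-radiating** (far energy `→ 0`
along a filter `l`). [folklore] -/
theorem farEnergy_lincomb_tendsto_zero {l : Filter ℝ} [l.NeBot]
    (hrad : ∀ m, Tendsto (fun t => ∫ x in Ioi (1 + |t|), (deriv (fun τ => B m τ x) t ^ 2
      + deriv (B m t) x ^ 2 + W x * B m t x ^ 2)) l (𝓝 0)) (c : Fin M → ℝ) (s : Finset (Fin M)) :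
    ∀ ψ : ℝ → ℝ → ℝ, ψ = (fun t x => ∑ m ∈ s, c m * B m t x) →
    Tendsto (fun t => ∫ x in Ioi (1 + |t|), (deriv (fun τ => ψ τ x) t ^ 2
      + deriv (ψ t) x ^ 2 + W x * ψ t x ^ 2)) l (𝓝 0) := by
  classical
  induction s using Finset.induction_on with
  | empty =>
    intro ψ hψ
    subst hψ
    simp only [sum_empty]
    have : (fun t : ℝ => ∫ x in Ioi (1 + |t|), (deriv (fun τ : ℝ => (0 : ℝ)) t ^ 2
        + deriv (fun y : ℝ => (0 : ℝ)) x ^ 2 + W x * (0 : ℝ) ^ 2)) = fun _ => 0 := by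
      funext t; simp
    rw [this]; exact tendsto_const_nhds
  | insert a s ha ih =>
    intro ψ hψ
    subst hψ
    rw [lincomb_insert ha]
    set ψ₁ : ℝ → ℝ → ℝ := fun t x => c a * B a t x with hψ₁
    set ψ₂ : ℝ → ℝ → ℝ := fun t x => ∑ m ∈ s, c m * B m t x with hψ₂
    have ih' := ih ψ₂ rfl
    -- the two summands as far solutions
    obtain ⟨g1, g2, g3⟩ := farSol_smul (W := W) (hB a) (hres a) (hint a) (c a)
    obtain ⟨h1, h2, h3⟩ := farSol_lincomb_finset hW hW0 hB hres hint c s ψ₂ rfl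
    obtain ⟨-, hEg, -⟩ := farSol_energy hW hW0 g1 g2 g3
    obtain ⟨-, hEh, -⟩ := farSol_energy hW hW0 h1 h2 h3
    -- the smul summand radiates nothing
    have hga : Tendsto (fun t => ∫ x in Ioi (1 + |t|), (deriv (fun τ => ψ₁ τ x) t ^ 2
        + deriv (ψ₁ t) x ^ 2 + W x * ψ₁ t x ^ 2)) l (𝓝 0) := by
      have e : (fun t => ∫ x in Ioi (1 + |t|), (deriv (fun τ => ψ₁ τ x) t ^ 2
          + deriv (ψ₁ t) x ^ 2 + W x * ψ₁ t x ^ 2))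
          = fun t => c a ^ 2 * ∫ x in Ioi (1 + |t|), (deriv (fun τ => B a τ x) t ^ 2
            + deriv (B a t) x ^ 2 + W x * B a t x ^ 2) := funext fun t => farEnergy_smul (c a) t
      rw [e]
      simpa using (hrad a).const_mul (c a ^ 2)
    -- squeeze with the subadditivity of `√E`
    have hsq : ∀ t, Real.sqrt (∫ x in Ioi (1 + |t|), (deriv (fun τ => ψ₁ τ x + ψ₂ τ x) t ^ 2
        + deriv (fun y => ψ₁ t y + ψ₂ t y) x ^ 2 + W x * (ψ₁ t x + ψ₂ t x) ^ 2))
        ≤ Real.sqrt (∫ x in Ioi (1 + |t|), (deriv (fun τ => ψ₁ τ x) t ^ 2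
          + deriv (ψ₁ t) x ^ 2 + W x * ψ₁ t x ^ 2))
          + Real.sqrt (∫ x in Ioi (1 + |t|), (deriv (fun τ => ψ₂ τ x) t ^ 2
          + deriv (ψ₂ t) x ^ 2 + W x * ψ₂ t x ^ 2)) :=
      fun t => (sqrt_farEnergy_add_le hW hW0 g1 h1 t (hEg t).1 (hEh t).1).2
    have hlim : Tendsto (fun t => (Real.sqrt (∫ x in Ioi (1 + |t|), (deriv (fun τ => ψ₁ τ x) t ^ 2
          + deriv (ψ₁ t) x ^ 2 + W x * ψ₁ t x ^ 2))
          + Real.sqrt (∫ x in Ioi (1 + |t|), (deriv (fun τ => ψ₂ τ x) t ^ 2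
          + deriv (ψ₂ t) x ^ 2 + W x * ψ₂ t x ^ 2))) ^ 2) l (𝓝 0) := by
      have := (hga.sqrt.add ih'.sqrt).pow 2
      simpa using this
    have h0 : ∀ t, 0 ≤ ∫ x in Ioi (1 + |t|), (deriv (fun τ => ψ₁ τ x + ψ₂ τ x) t ^ 2
        + deriv (fun y => ψ₁ t y + ψ₂ t y) x ^ 2 + W x * (ψ₁ t x + ψ₂ t x) ^ 2) := fun t =>
      setIntegral_nonneg measurableSet_Ioi fun x _ =>
        wave1D_energyDensity_nonneg (ψ := fun t x => ψ₁ t x + ψ₂ t x) hW0 t x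
    refine tendsto_of_tendsto_of_tendsto_of_le_of_le tendsto_const_nhds hlim (fun t => h0 t) (fun t => ?_)
    calc _ = Real.sqrt (∫ x in Ioi (1 + |t|), (deriv (fun τ => ψ₁ τ x + ψ₂ τ x) t ^ 2
          + deriv (fun y => ψ₁ t y + ψ₂ t y) x ^ 2 + W x * (ψ₁ t x + ψ₂ t x) ^ 2)) ^ 2 :=
          (Real.sq_sqrt (h0 t)).symm
      _ ≤ _ := pow_le_pow_left₀ (Real.sqrt_nonneg _) (hsq t) 2

end FarSol

/-- **Cauchy data of a combination** of `C²` functions. [folklore] -/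
theorem lincomb_data (hB : ∀ m, ContDiff ℝ 2 (Function.uncurry (B m))) (c : Fin M → ℝ)
    (s : Finset (Fin M)) (x : ℝ) :
    (fun t x => ∑ m ∈ s, c m * B m t x) 0 x = ∑ m ∈ s, c m * B m 0 x ∧
    deriv (fun τ => ∑ m ∈ s, c m * B m τ x) 0 = ∑ m ∈ s, c m * deriv (fun τ => B m τ x) 0 := by
  refine ⟨rfl, ?_⟩
  have hd : ∀ m, DifferentiableAt ℝ (fun τ => B m τ x) 0 := fun m =>
    (((hB m).comp (contDiff_id.prodMk contDiff_const)).differentiable (by norm_num)) 0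
  rw [deriv_fun_sum fun m _ => (hd m).const_mul (c m)]
  exact Finset.sum_congr rfl fun m _ => deriv_const_mul (c m) (hd m)

/-- **Combinations of `t`-polynomials on the unit far cone are `t`-polynomials there.** [folklore] -/
theorem tPolynomial_lincomb
    (hpoly : ∀ m, ∃ (N : ℕ) (a : ℕ → ℝ → ℝ), ∀ z : ℝ × ℝ, 1 + |z.1| < z.2 →
      B m z.1 z.2 = ∑ i ∈ Finset.range N, a i z.2 * z.1 ^ i) (c : Fin M → ℝ) (s : Finset (Fin M)) :
    ∃ (N : ℕ) (a : ℕ → ℝ → ℝ), ∀ z : ℝ × ℝ, 1 + |z.1| < z.2 →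
      (fun t x => ∑ m ∈ s, c m * B m t x) z.1 z.2 = ∑ i ∈ Finset.range N, a i z.2 * z.1 ^ i := by
  classical
  induction s using Finset.induction_on with
  | empty => exact ⟨0, fun _ _ => 0, fun z _ => by simp⟩
  | insert b s hb ih =>
    obtain ⟨N₁, a₁, h₁⟩ := ih
    obtain ⟨N₂, a₂, h₂⟩ := hpoly b
    refine ⟨N₁ + N₂, fun i x => (if i < N₁ then a₁ i x else 0) + c b * (if i < N₂ then a₂ i x else 0),
      fun z hz => ?_⟩
    show ∑ m ∈ insert b s, c m * B m z.1 z.2 = _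
    rw [sum_insert hb]
    have e1 : ∑ m ∈ s, c m * B m z.1 z.2 = ∑ i ∈ Finset.range (N₁ + N₂),
        (if i < N₁ then a₁ i z.2 else 0) * z.1 ^ i := by
      have := h₁ z hz
      simp only at this
      rw [this]
      rw [← Finset.sum_subset (Finset.range_subset_range.2 (Nat.le_add_right N₁ N₂))
        (fun i _ hi => by rw [if_neg (fun h => hi (Finset.mem_range.2 h)), zero_mul])]
      exact Finset.sum_congr rfl fun i hi => by rw [if_pos (Finset.mem_range.1 hi)]
    have e2 : c b * B b z.1 z.2 = ∑ i ∈ Finset.range (N₁ + N₂),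
        c b * (if i < N₂ then a₂ i z.2 else 0) * z.1 ^ i := by
      rw [h₂ z hz, Finset.mul_sum]
      rw [← Finset.sum_subset (Finset.range_subset_range.2 (Nat.le_add_left N₂ N₁))
        (fun i _ hi => by rw [if_neg (fun h => hi (Finset.mem_range.2 h))]; ring)]
      exact Finset.sum_congr rfl fun i hi => by rw [if_pos (Finset.mem_range.1 hi)]; ring
    rw [e1, e2, ← Finset.sum_add_distrib]
    exact Finset.sum_congr rfl fun i _ => by ring

end Literature.Analysis.PDE
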